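import Summits.BirchSwinnertonDyer.Rank1Residual.Additive.TwistPartnerForcedOfMeasure
import Summits.BirchSwinnertonDyer.Rank1Residual.Additive.TwistPartnerForcedTowerJoin
import Summits.BirchSwinnertonDyer.Rank1Residual.Additive.TypeGIntegralJ
import Literature.NumberTheory.EllipticCurves.Delbourgo1998.BoundedMeasure
import HarnessLib

/-!
# The tower-bounded forced partner FROM PRINT: Delbourgo 1998 Theorem 1 (named fact) delivers the
# defect-3/4/6 analytic input; per pair what remains is FINITE (the unit root, a sign certificate,
# one unit Riemann sum) (cell `b2b-bsdres`, sub-cell additive-p2 = X3♯(G-ord)/X4♯(G-ord), gen 25)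

HONEST FRAMING (cell `b2b-bsdres`, run/shared/lean/b2b/bsd-rank1-residual/, verbatim in every
file): the goal of the cell is to DELETE the COMBINATION-SHAPED residual classes of the
Birch–Swinnerton-Dyer formula for ALL analytic-rank `≤ 1` elliptic curves over `ℚ` — "full BSD
formula for every rank `≤ 1` curve in class `C`" assembled STRICTLY from published theorems — so
that the rank-`≤ 1` remainder becomes exactly the CONSTRUCTION-SHAPED classes, which are TYPED
(missing-input `Prop`s), NOT attempted. This is not "finishing BSD". Sub-cell additive-p2: the
classes X3♯(G-ord) / X4♯(G-ord) are CONSTRUCTION-SHAPED and stay so; labels / RESIDUAL-MAP marks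
UNCHANGED; nothing is booked. Theorems only; the named facts enter as hypothesis binders
(`Delbourgo1998.thm1_exists_bounded_evenMeasure` — NEW, this gen; `Delbourgo2002.mainTheorem`,
`….thmC_charIdeal_dvd_tameBranch`, `….mainTheorem_potMult`; GZK). No definition, no `sorry`.

## What

* §1 Two finite lemmas: the two characters of `ℤ/p` of order `e ∈ {3,4,6}` with values in `ℚ_p` are
  `χ` and `χ⁻¹` (`eq_or_eq_inv_of_orderOf_eq`); a `p`-adic UNIT root of `X² − AX + p` is unique
  (`eq_of_unit_root`).
* §2 **`exists_towerBounded_forced_of_thm1`**: on the (G)-ordinary additive locus at `p ≥ 5` with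
  defect `e ∈ {3,4,6}`, Delbourgo 1998 Thm. 1 (the named fact) + `towerBounded_forced_of_measure`
  give a character `χ₀` of order `e`, the unit root `ã₀` of Frobenius over a (G)-field, and TOWER
  BOUNDEDNESS of the forced partner `forced χ₀ [·]⁺_f ã₀` — the typed analytic input of gen 23/24
  (`HasOrdinaryTwistPartner` on the tower / `hC₀` of the joins) is now a CONSEQUENCE OF A NAMED
  PUBLISHED THEOREM, up to the one bit "`χ₀ = ω^{t}` or `ω^{−t}`" which print does not assert.
* §3 **Per pair, everything left is finite**: a (G)-field `F ⊆ ℚ(ζ_p)` with a place `w ∣ p` and the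
  unit root `ã` of `X² − a_w(E_F)X + p`; a character `χ` of order `e` with ONE tower value
  `‖forced χ⁻¹ [·]⁺_f ã (a₀/p^{n₀})‖_p > p^c` (the SIGN CERTIFICATE: a tower-bounded partner never exceeds
  the plus-symbol bound, `norm_towerSup_le_of_twist_partner`, so the bounded character is `χ`); ONE
  Riemann sum `‖RS 1 n‖_p = p^c`. With Delbourgo 2002 (A)(B)(C) + GZK: `CharLamLeAt`, and Schneider for
  Delbourgo's datum at `ord_{s=1}L(E,s) = 1` on X4♯(G-ord) (`c = 0`) / X3♯(G-ord). Nothing booked.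

References: Delbourgo, Compositio Math. 113 (1998) Thm. 1 [Delbourgo1998]; J. Number Theory 95 (2002)
Thm. (A)–(C) [Delbourgo2002]; Mazur–Tate–Teitelbaum 1986 §I.10 [MazurTateTeitelbaum1986Invent]. -/

noncomputable section

open scoped Classical MatrixGroups ModularForm NumberField

open CongruenceSubgroup IsDedekindDomain WeierstrassCurve NumberField
  Literature.NumberTheory.EllipticCurves
  Literature.NumberTheory.EllipticCurves.ModularForms
  Literature.NumberTheory.EllipticCurves.Rank1Residual
  Literature.NumberTheory.EllipticCurves.Rank1Residual.Typed
  Literature.NumberTheory.EllipticCurves.Delbourgo2002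
  Summit.BirchSwinnertonDyer.Rank1Residual.X1.MuLambda
  Summit.BirchSwinnertonDyer.Rank1Residual.X11a.LambdaNorm

namespace Summit.BirchSwinnertonDyer.Rank1Residual.Additive

namespace TwistPartner

/-! ### §1 Finite lemmas: the two characters of order `e ∈ {3,4,6}`; the unit root is unique -/

section Finite

variable {p : ℕ} [hp : Fact p.Prime]

/-- **The characters of order `e ∈ {3,4,6}` are `χ^{±1}`**: two `ℚ_p`-valued characters of `ℤ/p` of
the same order `e ∈ {3, 4, 6}` are equal or inverse to each other (`φ(e) = 2`). [folklore] -/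
theorem eq_or_eq_inv_of_orderOf_eq {χ ψ : MulChar (ZMod p) ℚ_[p]} {e : ℕ}
    (he : e ∈ ({3, 4, 6} : Finset ℕ)) (hχ : orderOf χ = e) (hψ : orderOf ψ = e) :
    ψ = χ ∨ ψ = χ⁻¹ := by
  haveI : NeZero e := ⟨by simp only [Finset.mem_insert, Finset.mem_singleton] at he; omega⟩
  have he0 : 0 < e := Nat.pos_of_ne_zero (NeZero.ne e)
  obtain ⟨g, hg⟩ := IsCyclic.exists_generator (α := (ZMod p)ˣ)
  have hpow : ∀ u : (ZMod p)ˣ, ∃ m : ℕ, g ^ m = u := fun u ↦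
    (Submonoid.mem_powers_iff _ _).mp (((isOfFinOrder_of_finite g).mem_powers_iff_mem_zpowers).mpr (hg u))
  -- orders of characters are orders of their value at the generator
  have hord : ∀ φ : MulChar (ZMod p) ℚ_[p], orderOf φ = orderOf (φ g) := by
    intro φ
    rw [orderOf_eq_orderOf_iff]
    intro n
    constructor
    · intro h
      rw [← MulChar.pow_apply_coe, h, MulChar.one_apply_coe]
    · intro h
      ext u
      obtain ⟨m, rfl⟩ := hpow u
      rw [MulChar.pow_apply_coe, MulChar.one_apply_coe, Units.val_pow_eq_pow_val, map_pow, ← pow_mul,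
        mul_comm, pow_mul, h, one_pow]
  have hζ : IsPrimitiveRoot (χ g) e := by rw [← hχ, hord χ]; exact IsPrimitiveRoot.orderOf _
  have hξ : (ψ g) ^ e = 1 := by rw [← hψ, hord ψ]; exact pow_orderOf_eq_one _
  obtain ⟨i, hi, hiξ⟩ := hζ.eq_pow_of_pow_eq_one hξ
  have hprim : IsPrimitiveRoot (χ g ^ i) e := by rw [hiξ, ← hψ, hord ψ]; exact IsPrimitiveRoot.orderOf _
  have hcop : i.Coprime e := (hζ.pow_iff_coprime he0 i).mp hprim
  -- `i ∈ {1, e − 1}`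
  have hi' : i = 1 ∨ i = e - 1 := by
    simp only [Finset.mem_insert, Finset.mem_singleton] at he
    rcases he with rfl | rfl | rfl <;> interval_cases i <;> simp_all (config := {decide := true})
  -- characters agree on the generator, hence everywhere
  have hext : ∀ φ φ' : MulChar (ZMod p) ℚ_[p], φ g = φ' g → φ = φ' := by
    intro φ φ' h
    ext u
    obtain ⟨m, rfl⟩ := hpow u
    rw [Units.val_pow_eq_pow_val, map_pow, map_pow, h]
  rcases hi' with rfl | rfl
  · left
    exact hext _ _ (by rw [← hiξ, pow_one])
  · right
    apply hext
    rw [← hiξ, MulChar.inv_apply_eq_inv']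
    have h1 : χ g ^ (e - 1) * χ g = 1 := by rw [← pow_succ, Nat.sub_add_cancel he0, hζ.pow_eq_one]
    exact eq_inv_of_mul_eq_one_left h1

/-- **The `p`-adic unit root of `X² − AX + p` is unique.** [folklore] -/
theorem eq_of_unit_root {A : ℚ_[p]} {a a' : ℚ_[p]} (ha : ‖a‖ = 1) (ha' : ‖a'‖ = 1)
    (hra : a ^ 2 - A * a + p = 0) (hra' : a' ^ 2 - A * a' + p = 0) : a' = a := by
  by_contra hne
  have hsum : a + a' = A := by
    have h : (a' - a) * (a' + a - A) = 0 := by linear_combination hra' - hra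
    rcases mul_eq_zero.mp h with h1 | h1
    · exact absurd (sub_eq_zero.mp h1) hne
    · linear_combination h1
  have hprod : a * a' = p := by
    have h : a' = A - a := by linear_combination hsum
    rw [h]; linear_combination -hra
  have hnorm : ‖a * a'‖ = 1 := by rw [norm_mul, ha, ha', one_mul]
  rw [hprod, Padic.norm_p] at hnorm
  have hp1 : (1 : ℝ) < p := by exact_mod_cast hp.out.one_lt
  have : (p : ℝ)⁻¹ < 1 := inv_lt_one_of_one_lt₀ hp1
  exact absurd hnorm this.ne

end Finite

/-! ### §2 The tower-bounded forced partner from Delbourgo 1998 Theorem 1 -/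

section FromPrint

variable {W : WeierstrassCurve ℚ} [W.IsElliptic] [W.IsGloballyMinimal] {p : ℕ} [hp : Fact p.Prime]
  {N : ℕ} [NeZero N] {f : CuspForm (Gamma0 N) 2}

/-- **THE DEFECT-3/4/6 ANALYTIC INPUT FROM PRINT.** On the (G)-ordinary ADDITIVE locus at `p ≥ 5` with
defect `e = semistabilityIndex W p ∈ {3, 4, 6}`, for the newform `f` of `E = W`: Delbourgo 1998
Theorem 1 (the named fact `Delbourgo1998.thm1_exists_bounded_evenMeasure`) yields a character `χ₀` of
`ℤ/p` (values in `ℚ_p`) of exact order `e`, a `p`-adic unit `ã₀` which is the unit root of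
`X² − a_w(E_F)X + p` at some place `w ∣ p` of some (G)-field `F` (good reduction there), and a TOWER
BOUND for the forced twist partner: `‖forced χ₀ [·]⁺_f ã₀ (a/pⁿ)‖_p ≤ C₀` for all `n, a` — the
analytic input of `exists_isTameBranchOf_riemannSum_of_towerBounded_forced` and of the gen-24 joins,
hitherto TYPED (census `OrdinaryTwistPartnerAt`, up to the sign of the exponent). Nothing booked.
[cite: Delbourgo1998, Theorem 1 (p. 131), pp. 132–133] [cite: MazurTateTeitelbaum1986Invent, §I.10] -/
theorem exists_towerBounded_forced_of_thm1 (hD : Delbourgo1998.thm1_exists_bounded_evenMeasure)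
    (h5 : 5 ≤ p) (hadd : Addv W p) (hGord : TypeGOrd W p)
    (he : semistabilityIndex W p ∈ ({3, 4, 6} : Finset ℕ)) (hf : IsNewformOf W f) :
    ∃ (χ₀ : MulChar (ZMod p) ℚ_[p]) (ã₀ : ℚ_[p]),
      orderOf χ₀ = semistabilityIndex W p ∧ ‖ã₀‖ = 1 ∧
      (∃ (L : Type) (_ : Field L) (_ : NumberField L) (_ : IsCyclotomicExtension {p} ℚ L)
          (F : IntermediateField ℚ L) (w : HeightOneSpectrum (𝓞 F)),
          (p : 𝓞 F) ∈ w.asIdeal ∧ (W.baseChange F).HasGoodReductionAt w ∧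
            ã₀ ^ 2 - (((W.baseChange F).frobeniusTraceAt w : ℤ) : ℚ_[p]) * ã₀ + p = 0) ∧
      ∃ C₀ : ℝ, ∀ (n : ℕ) (a : ℤ),
        ‖forced χ₀ (fun r ↦ ((ratPlusSymbol f r : ℚ) : ℚ_[p])) ã₀ ((a : ℚ) / (p : ℚ) ^ n)‖ ≤ C₀ := by
  obtain ⟨L, iF, iN, iC, F, hF⟩ := hGord
  obtain ⟨w, hw⟩ := exists_heightOneSpectrum_natCast_mem F p
  obtain ⟨ε, a, μ, hord, ha, hroot, ⟨C, hbd⟩, hdist, hW, hT0, hT1, hTε⟩ :=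
    hD W p h5 hadd he L F hF w hw f hf
  have hε1 : ε ≠ 1 := by
    intro h
    rw [h, orderOf_one] at hord
    simp only [Finset.mem_insert, Finset.mem_singleton, semistabilityIndex] at he
    omega
  have hU0 := sum_ratPlusSymbol_add_div_eq_zero_of_addv W hf hadd
  obtain ⟨C₀, hC₀⟩ := towerBounded_forced_of_measure hε1 ha hU0 hbd hdist hW hT0 hT1 hTε
  exact ⟨ε, a, hord, ha, ⟨L, iF, iN, iC, F, w, hw, (hF w hw).1, hroot⟩, C₀, hC₀⟩

/-- **PER PAIR: the SIGN CERTIFICATE pins the character, the unit root pins the unit.** Data: a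
(G)-field `F` (inside a `p`-th cyclotomic field) with good ordinary reduction above `p`, a place
`w ∣ p`, the unit root `ã` of `X² − a_w(E_F)X + p`, a character `χ` of order `e`, a tower bound `C`
for the plus symbols, and ONE tower value of the forced partner of the CONJUGATE character beyond
that bound: `C < ‖forced χ⁻¹ [·]⁺_f ã (a₀/p^{n₀})‖_p`. Then (Delbourgo 1998 Thm. 1 as a named fact)
the forced partner of `(χ, ã)` is bounded on the tower. Mechanism: the fact's pair `(χ₀, ã₀)` has
`ã₀ = ã` (unique unit root) and `χ₀ ∈ {χ, χ⁻¹}` (order `e`); a tower-bounded partner never exceeds the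
plus-symbol bound (`norm_towerSup_le_of_twist_partner`), so `χ₀ ≠ χ⁻¹`. Nothing booked.
[cite: Delbourgo1998, Theorem 1 (p. 131), pp. 132–133] [cite: MazurTateTeitelbaum1986Invent, §I.8, §I.10] -/
theorem towerBounded_forced_of_thm1_of_signCert (hD : Delbourgo1998.thm1_exists_bounded_evenMeasure)
    (h5 : 5 ≤ p) (hadd : Addv W p) (he : semistabilityIndex W p ∈ ({3, 4, 6} : Finset ℕ))
    (hf : IsNewformOf W f)
    {L : Type} [Field L] [NumberField L] [IsCyclotomicExtension {p} ℚ L] (F : IntermediateField ℚ L)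
    (hF : ∀ w : HeightOneSpectrum (𝓞 F), (p : 𝓞 F) ∈ w.asIdeal →
      (W.baseChange F).HasGoodReductionAt w ∧ (W.baseChange F).HasUnitRootAt w)
    (w : HeightOneSpectrum (𝓞 F)) (hw : (p : 𝓞 F) ∈ w.asIdeal)
    {ã : ℚ_[p]} (hã : ‖ã‖ = 1)
    (hroot : ã ^ 2 - (((W.baseChange F).frobeniusTraceAt w : ℤ) : ℚ_[p]) * ã + p = 0)
    {χ : MulChar (ZMod p) ℚ_[p]} (hχe : orderOf χ = semistabilityIndex W p)
    {C : ℝ} (hC : ∀ (n : ℕ) (a : ℤ), ‖((ratPlusSymbol f ((a : ℚ) / (p : ℚ) ^ n) : ℚ) : ℚ_[p])‖ ≤ C)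
    (hsign : ∃ (n₀ : ℕ) (a₀ : ℤ),
      C < ‖forced χ⁻¹ (fun r ↦ ((ratPlusSymbol f r : ℚ) : ℚ_[p])) ã ((a₀ : ℚ) / (p : ℚ) ^ n₀)‖) :
    ∃ C₀ : ℝ, ∀ (n : ℕ) (a : ℤ),
      ‖forced χ (fun r ↦ ((ratPlusSymbol f r : ℚ) : ℚ_[p])) ã ((a : ℚ) / (p : ℚ) ^ n)‖ ≤ C₀ := by
  obtain ⟨ε, a, μ, hord, ha, hroot', ⟨C', hbd⟩, hdist, hW, hT0, hT1, hTε⟩ :=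
    hD W p h5 hadd he L F hF w hw f hf
  -- the unit is pinned
  obtain rfl : a = ã := eq_of_unit_root hã ha hroot hroot'
  have hε1 : ε ≠ 1 := by
    intro h
    rw [h, orderOf_one] at hord
    simp only [Finset.mem_insert, Finset.mem_singleton, semistabilityIndex] at he
    omega
  have hU0 := sum_ratPlusSymbol_add_div_eq_zero_of_addv W hf hadd
  obtain ⟨C₀, hC₀⟩ := towerBounded_forced_of_measure hε1 hã hU0 hbd hdist hW hT0 hT1 hTε
  -- the character is `χ` or `χ⁻¹`; the sign certificate excludes `χ⁻¹`
  rcases eq_or_eq_inv_of_orderOf_eq he hχe (hord.trans rfl) with rfl | rfl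
  · exact ⟨C₀, hC₀⟩
  · exfalso
    obtain ⟨n₀, a₀, hlt⟩ := hsign
    set x : ℚ → ℚ_[p] := fun r ↦ ((ratPlusSymbol f r : ℚ) : ℚ_[p]) with hxdef
    have hperx : ∀ s, x (s + 1) = x s := fun s ↦ by
      simp only [hxdef]
      rw [show (s + 1 : ℚ) = s + ((1 : ℤ) : ℚ) by push_cast; rfl, ratPlusSymbol_add_intCast_eq]
    have hU0' : ∀ s, ∑ d : ZMod p, x (s + (d.val : ℚ) / p) = 0 := fun s ↦ by
      simp only [hxdef]
      exact_mod_cast congrArg (fun q : ℚ ↦ (q : ℚ_[p])) (hU0 s)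
    obtain ⟨hper', hx', hU'⟩ := forced_isPartner hε1 hã hperx hU0'
    obtain ⟨n₁, a₁, hs₁⟩ := exists_towerSup_of_towerBounded hC₀
    have hle := norm_towerSup_le_of_twist_partner χ⁻¹ hε1 hã hper' (fun s ↦ hx' s) hU' hs₁ hC
    exact (lt_irrefl _) ((hlt.trans_le (hs₁ n₀ a₀)).trans_le hle)

end FromPrint

/-! ### §3 X4♯(G-ord), rank one: Schneider from printed facts + three finite per-pair data -/

section Join

variable {W : WeierstrassCurve ℚ} [W.IsElliptic] [W.IsGloballyMinimal] {p : ℕ} [hp : Fact p.Prime]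
  {N : ℕ} [NeZero N] {f : CuspForm (Gamma0 N) 2} {χ : MulChar (ZMod p) ℚ_[p]} {ã : ℚ_[p]}
  {RS : ℕ → ℕ → ℚ_[p]}
  (hRS : ∀ k n : ℕ, RS k n =
      ∑ᶠ ξ : rootsOfUnity (Literature.NumberTheory.EllipticCurves.torsionOrder p) ℤ_[p],
        ∑ s : ZMod (p ^ n),
        twistPartnerMeasure χ
            (TwistPartner.forced χ (fun r ↦ ((ratPlusSymbol f r : ℚ) : ℚ_[p])) ã) ã
            ((ratPlusSymbol f 0 : ℚ) : ℚ_[p]) (n + cyclotomicExponent p)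
            (PadicInt.toZModPow (n + cyclotomicExponent p) ((ξ : ℤ_[p]ˣ) : ℤ_[p]) *
              (cyclotomicGenerator p : ZMod (p ^ (n + cyclotomicExponent p))) ^ s.val) *
          ((s.val.choose k : ℕ) : ℚ_[p]))

include hRS

/-- **THE JOIN FROM PRINT + FINITE DATA** (general locus: `p ≥ 5`, ADDITIVE, (G)-ORDINARY, defect
`e ∈ {3,4,6}`, non-CM): Delbourgo 1998 Thm. 1 + Delbourgo 2002 (A)(C) (named facts) + a (G)-field `F`
with a place `w ∣ p` and the unit root `ã` of `X² − a_w(E_F)X + p` + a character `χ` of order `e` + the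
tower bound `‖[a/pⁿ]⁺_f‖_p ≤ p^c` + the SIGN CERTIFICATE `p^c < ‖forced χ⁻¹ [·]⁺_f ã (a₀/p^{n₀})‖_p` +
ONE Riemann sum `‖RS k n‖_p = p^c` (`k < p`, `n ≥ 1`) ⟹ `CharLamLeAt W p k`. No tower-boundedness
hypothesis. [cite: Delbourgo1998, Theorem 1 (p. 131)] [cite: Delbourgo2002, Theorem (A), (C) (p. 40)]
[cite: SteinWuthrich2013, §3] -/
theorem charLamLeAt_of_thm1_of_signCert_of_riemannSum
    (hD : Delbourgo1998.thm1_exists_bounded_evenMeasure)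
    (hC : Delbourgo2002.thmC_charIdeal_dvd_tameBranch) (hDel : Delbourgo2002.mainTheorem)
    (hDelM : Delbourgo2002.mainTheorem_potMult) (h5 : 5 ≤ p) (hcm : ¬ W.HasCM) (hadd : Addv W p)
    (hGord : TypeGOrd W p) (he : semistabilityIndex W p ∈ ({3, 4, 6} : Finset ℕ))
    (hf : IsNewformOf W f)
    {L : Type} [Field L] [NumberField L] [IsCyclotomicExtension {p} ℚ L] (F : IntermediateField ℚ L)
    (hF : ∀ w : HeightOneSpectrum (𝓞 F), (p : 𝓞 F) ∈ w.asIdeal →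
      (W.baseChange F).HasGoodReductionAt w ∧ (W.baseChange F).HasUnitRootAt w)
    (w : HeightOneSpectrum (𝓞 F)) (hw : (p : 𝓞 F) ∈ w.asIdeal)
    (hã : ‖ã‖ = 1) (hroot : ã ^ 2 - (((W.baseChange F).frobeniusTraceAt w : ℤ) : ℚ_[p]) * ã + p = 0)
    (hχe : orderOf χ = semistabilityIndex W p) {c : ℕ}
    (hc : ∀ (m : ℕ) (a : ℤ), ‖((ratPlusSymbol f ((a : ℚ) / (p : ℚ) ^ m) : ℚ) : ℚ_[p])‖ ≤ (p : ℝ) ^ c)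
    (hsign : ∃ (n₀ : ℕ) (a₀ : ℤ), (p : ℝ) ^ c <
      ‖TwistPartner.forced χ⁻¹ (fun r ↦ ((ratPlusSymbol f r : ℚ) : ℚ_[p])) ã ((a₀ : ℚ) / (p : ℚ) ^ n₀)‖)
    {k n : ℕ} (hk : k < p) (hn : 1 ≤ n) (heq : ‖RS k n‖ = (p : ℝ) ^ c) : CharLamLeAt W p k := by
  have hp2 : p ≠ 2 := by omega
  have hG : SubGord W p := (subGord_iff_typeG_of_addv W p hp2 hadd).mpr hGord.typeG
  obtain ⟨C₀, hC₀⟩ := TwistPartner.towerBounded_forced_of_thm1_of_signCert hD h5 hadd he hf F hF w hw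
    hã hroot hχe hc hsign
  have hne : χ ≠ 1 := by
    intro h
    rw [h, orderOf_one] at hχe
    simp only [Finset.mem_insert, Finset.mem_singleton] at he
    omega
  have hU0 := sum_ratPlusSymbol_add_div_eq_zero_of_addv W hf hadd
  have hT : TameBranchRatDvdAt W p := tameBranchRatDvdAt_of_thmC hC hDel hDelM h5 hcm
  obtain ⟨B, hB, hint, -⟩ :=
    exists_isTameBranchOf_riemannSum_of_towerBounded_forced hRS hne hã hU0 hC₀
  have hord : orderOf (χ.ringHomComp (algebraMap ℚ_[p] ℂ_[p])) = tameDefect W p := by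
    rw [orderOf_ringHomComp_padicComplex, hχe, tameDefect_of_not_potMult W p hG.1]
  have hbd : ∀ j : ℕ, ‖PowerSeries.coeff j B‖ ≤ (p : ℝ) ^ c := hint _ hc
  have hk' : ‖PowerSeries.coeff k B‖ = (p : ℝ) ^ c :=
    hB.norm_coeff_eq_pow_of_forcedRiemannSum_tower hRS hne hã hU0 hC₀ hc hk hn heq
  exact charLamLeAt_of_tameBranchRatDvdAt_of_norm_le_pow_of_norm_coeff_eq_pow hT hp2 hadd
    (Or.inr hGord) hf hord hã hB hbd hk'

/-- **`ord_{s=1}L(E,s) = 1`: Schneider for Delbourgo's datum from print + finite data** (general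
locus as above, `k = 1`): Delbourgo 1998 Thm. 1, 2002 (A)(B)(C), GZK + unit root + sign certificate +
`‖RS 1 n‖_p = p^c`. [cite: Delbourgo1998, Theorem 1 (p. 131)] [cite: Delbourgo2002, Theorem (A), (B), (C) (p. 40)] -/
theorem exists_schneider_rankOne_of_thm1_of_signCert_of_riemannSum
    (hD : Delbourgo1998.thm1_exists_bounded_evenMeasure)
    (hC : Delbourgo2002.thmC_charIdeal_dvd_tameBranch) (hDel : Delbourgo2002.mainTheorem)
    (hDelM : Delbourgo2002.mainTheorem_potMult) (hGZK : rank_eq_analyticRank_of_analyticRank_le_one)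
    (h5 : 5 ≤ p) (hcm : ¬ W.HasCM) (hadd : Addv W p) (hGord : TypeGOrd W p)
    (he : semistabilityIndex W p ∈ ({3, 4, 6} : Finset ℕ)) (hr : W.analyticRank = 1)
    (hf : IsNewformOf W f)
    {L : Type} [Field L] [NumberField L] [IsCyclotomicExtension {p} ℚ L] (F : IntermediateField ℚ L)
    (hF : ∀ w : HeightOneSpectrum (𝓞 F), (p : 𝓞 F) ∈ w.asIdeal →
      (W.baseChange F).HasGoodReductionAt w ∧ (W.baseChange F).HasUnitRootAt w)
    (w : HeightOneSpectrum (𝓞 F)) (hw : (p : 𝓞 F) ∈ w.asIdeal)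
    (hã : ‖ã‖ = 1) (hroot : ã ^ 2 - (((W.baseChange F).frobeniusTraceAt w : ℤ) : ℚ_[p]) * ã + p = 0)
    (hχe : orderOf χ = semistabilityIndex W p) {c : ℕ}
    (hc : ∀ (m : ℕ) (a : ℤ), ‖((ratPlusSymbol f ((a : ℚ) / (p : ℚ) ^ m) : ℚ) : ℚ_[p])‖ ≤ (p : ℝ) ^ c)
    (hsign : ∃ (n₀ : ℕ) (a₀ : ℤ), (p : ℝ) ^ c <
      ‖TwistPartner.forced χ⁻¹ (fun r ↦ ((ratPlusSymbol f r : ℚ) : ℚ_[p])) ã ((a₀ : ℚ) / (p : ℚ) ^ n₀)‖)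
    {n : ℕ} (hn : 1 ≤ n) (heq : ‖RS 1 n‖ = (p : ℝ) ^ c) :
    (∀ Dh : PAdicHeightData W p, LeadingTermClauses W p Dh → SchneiderConjecture Dh) ∧
      ∃ Dh : PAdicHeightData W p, LeadingTermClauses W p Dh ∧ SchneiderConjecture Dh := by
  have hlam1 : CharLamLeAt W p 1 :=
    TwistPartner.charLamLeAt_of_thm1_of_signCert_of_riemannSum hRS hD hC hDel hDelM h5 hcm hadd hGord he
      hf F hF w hw hã hroot hχe hc hsign (by omega) hn heq
  obtain ⟨hmw, -⟩ := hGZK W (by rw [hr])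
  have hr1 : W.mordellWeilRank = 1 := by rw [hmw, hr]
  have hlam : CharLamLeAt W p W.mordellWeilRank := by rw [hr1]; exact hlam1
  have hA : ∀ (κ : ZpExtension ℚ p) (γ : Field.absoluteGaloisGroup ℚ),
      κ.IsCyclotomic → κ.IsTopGenerator γ → ∀ D : W.SelmerDualData κ γ, D.IsTorsion :=
    fun _ _ hκ hγ D ↦ Delbourgo2002.mainTheorem.isTorsion hDel h5 hcm hadd hGord hκ hγ D
  have hS : ∀ Dh : PAdicHeightData W p, LeadingTermClauses W p Dh → SchneiderConjecture Dh :=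
    fun Dh hBcl ↦ (schneider_and_finite_of_charLamLe W p hBcl hA hlam).1
  obtain ⟨Dh, hBcl⟩ := Delbourgo2002.mainTheorem.exists_leadingTermClauses hDel h5 hcm hadd hGord
  exact ⟨hS, Dh, hBcl, hS Dh hBcl⟩

/-- **X4♯(G-ord), defect 3, 4, 6, `ord_{s=1}L(E,s) = 1`, `p ≥ 5`, non-CM — Schneider for Delbourgo's
datum from PRINTED facts (Delbourgo 1998 Thm. 1; Delbourgo 2002 (A), (B), (C); GZK; Drinfeld–Manin
integrality on X4) and THREE FINITE per-pair data: a (G)-field `F` with a place `w ∣ p` and the unit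
root `ã` of `X² − a_w(E_F)X + p`; a character `χ` of order `e` with the SIGN CERTIFICATE
`1 < ‖forced χ⁻¹ [·]⁺_f ã (a₀/p^{n₀})‖_p` (one tower value); ONE unit Riemann sum `‖RS 1 n‖_p = 1`.**
No tower-boundedness hypothesis, no `OrdinaryTwistPartnerAt`, no `∀`-certificate. The sharpest form of
this sub-cell's rank-one residue on X4♯(G-ord) ∩ {e ∈ {3,4,6}}. Nothing booked; X4♯(G-ord) stays
CONSTRUCTION-SHAPED. [cite: Delbourgo1998, Theorem 1 (p. 131)]
[cite: Delbourgo2002, Theorem (A), (B), (C) (p. 40)] [cite: Manin1972, Cor. 3.6] [cite: SteinWuthrich2013, §3] -/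
theorem ClassX4Gord.exists_schneider_rankOne_of_thm1_of_signCert_of_riemannSum
    (hD : Delbourgo1998.thm1_exists_bounded_evenMeasure)
    (hC : Delbourgo2002.thmC_charIdeal_dvd_tameBranch) (hDel : Delbourgo2002.mainTheorem)
    (hDelM : Delbourgo2002.mainTheorem_potMult) (hGZK : rank_eq_analyticRank_of_analyticRank_le_one)
    (hX : ClassX4Gord W p) (h5 : 5 ≤ p) (hcm : ¬ W.HasCM)
    (he : semistabilityIndex W p ∈ ({3, 4, 6} : Finset ℕ)) (hr : W.analyticRank = 1)
    (hf : IsNewformOf W f)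
    {L : Type} [Field L] [NumberField L] [IsCyclotomicExtension {p} ℚ L] (F : IntermediateField ℚ L)
    (hF : ∀ w : HeightOneSpectrum (𝓞 F), (p : 𝓞 F) ∈ w.asIdeal →
      (W.baseChange F).HasGoodReductionAt w ∧ (W.baseChange F).HasUnitRootAt w)
    (w : HeightOneSpectrum (𝓞 F)) (hw : (p : 𝓞 F) ∈ w.asIdeal)
    (hã : ‖ã‖ = 1) (hroot : ã ^ 2 - (((W.baseChange F).frobeniusTraceAt w : ℤ) : ℚ_[p]) * ã + p = 0)
    (hχe : orderOf χ = semistabilityIndex W p)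
    (hsign : ∃ (n₀ : ℕ) (a₀ : ℤ),
      1 < ‖TwistPartner.forced χ⁻¹ (fun r ↦ ((ratPlusSymbol f r : ℚ) : ℚ_[p])) ã
        ((a₀ : ℚ) / (p : ℚ) ^ n₀)‖)
    {n : ℕ} (hn : 1 ≤ n) (hunit : ‖RS 1 n‖ = 1) :
    (∀ Dh : PAdicHeightData W p, LeadingTermClauses W p Dh → SchneiderConjecture Dh) ∧
      ∃ Dh : PAdicHeightData W p, LeadingTermClauses W p Dh ∧ SchneiderConjecture Dh := by
  have hc : ∀ (m : ℕ) (a : ℤ),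
      ‖((ratPlusSymbol f ((a : ℚ) / (p : ℚ) ^ m) : ℚ) : ℚ_[p])‖ ≤ (p : ℝ) ^ (0 : ℕ) := fun m a ↦ by
    rw [pow_zero]
    exact plusSymbolsPIntegralAt_of_classX4 W p hX.1 f hf _
  have hsign' : ∃ (n₀ : ℕ) (a₀ : ℤ), (p : ℝ) ^ (0 : ℕ) <
      ‖TwistPartner.forced χ⁻¹ (fun r ↦ ((ratPlusSymbol f r : ℚ) : ℚ_[p])) ã
        ((a₀ : ℚ) / (p : ℚ) ^ n₀)‖ := by
    obtain ⟨n₀, a₀, h⟩ := hsign; exact ⟨n₀, a₀, by rwa [pow_zero]⟩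
  exact TwistPartner.exists_schneider_rankOne_of_thm1_of_signCert_of_riemannSum hRS hD hC hDel hDelM
    hGZK h5 hcm hX.addv.2 hX.typeGOrd he hr hf F hF w hw hã hroot hχe hc hsign' hn
    (by rw [pow_zero]; exact hunit)

/-- **X3♯(G-ord), defect 3, 4, 6, `ord_{s=1}L(E,s) = 1`, `p ≥ 5`, non-CM** — the twin with the tower
bound `p^c` of the plus symbols: printed facts + unit root + sign certificate `p^c < ‖forced χ⁻¹ … ‖` +
`‖RS 1 n‖_p = p^c` ⟹ Schneider for Delbourgo's datum. Nothing booked; X3♯(G-ord) CONSTRUCTION-SHAPED.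
[cite: Delbourgo1998, Theorem 1 (p. 131)] [cite: Delbourgo2002, Theorem (A), (B), (C) (p. 40)] -/
theorem ClassX3Gord.exists_schneider_rankOne_of_thm1_of_signCert_of_riemannSum
    (hD : Delbourgo1998.thm1_exists_bounded_evenMeasure)
    (hC : Delbourgo2002.thmC_charIdeal_dvd_tameBranch) (hDel : Delbourgo2002.mainTheorem)
    (hDelM : Delbourgo2002.mainTheorem_potMult) (hGZK : rank_eq_analyticRank_of_analyticRank_le_one)
    (hX : ClassX3Gord W p) (h5 : 5 ≤ p) (hcm : ¬ W.HasCM)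
    (he : semistabilityIndex W p ∈ ({3, 4, 6} : Finset ℕ)) (hr : W.analyticRank = 1)
    (hf : IsNewformOf W f)
    {L : Type} [Field L] [NumberField L] [IsCyclotomicExtension {p} ℚ L] (F : IntermediateField ℚ L)
    (hF : ∀ w : HeightOneSpectrum (𝓞 F), (p : 𝓞 F) ∈ w.asIdeal →
      (W.baseChange F).HasGoodReductionAt w ∧ (W.baseChange F).HasUnitRootAt w)
    (w : HeightOneSpectrum (𝓞 F)) (hw : (p : 𝓞 F) ∈ w.asIdeal)
    (hã : ‖ã‖ = 1) (hroot : ã ^ 2 - (((W.baseChange F).frobeniusTraceAt w : ℤ) : ℚ_[p]) * ã + p = 0)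
    (hχe : orderOf χ = semistabilityIndex W p) {c : ℕ}
    (hc : ∀ (m : ℕ) (a : ℤ), ‖((ratPlusSymbol f ((a : ℚ) / (p : ℚ) ^ m) : ℚ) : ℚ_[p])‖ ≤ (p : ℝ) ^ c)
    (hsign : ∃ (n₀ : ℕ) (a₀ : ℤ), (p : ℝ) ^ c <
      ‖TwistPartner.forced χ⁻¹ (fun r ↦ ((ratPlusSymbol f r : ℚ) : ℚ_[p])) ã ((a₀ : ℚ) / (p : ℚ) ^ n₀)‖)
    {n : ℕ} (hn : 1 ≤ n) (heq : ‖RS 1 n‖ = (p : ℝ) ^ c) :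
    (∀ Dh : PAdicHeightData W p, LeadingTermClauses W p Dh → SchneiderConjecture Dh) ∧
      ∃ Dh : PAdicHeightData W p, LeadingTermClauses W p Dh ∧ SchneiderConjecture Dh :=
  TwistPartner.exists_schneider_rankOne_of_thm1_of_signCert_of_riemannSum hRS hD hC hDel hDelM hGZK
    h5 hcm hX.addv hX.typeGOrd he hr hf F hF w hw hã hroot hχe hc hsign hn heq

end Join

end TwistPartner

end Summit.BirchSwinnertonDyer.Rank1Residual.Additive

end
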